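import Summits.BirchSwinnertonDyer.Rank1Residual.Additive.X3BranchAnalyticHalfGordEndState
import Summits.BirchSwinnertonDyer.Rank1Residual.Additive.QuadraticBranchLowerDescentSemistable
import Summits.BirchSwinnertonDyer.Rank1Residual.Additive.X3BranchLowerDescent
import HarnessLib

/-!
# X3 on the semistable-twist locus, cell (G-ord, `e = 2`): TWIST DESCENT of the one open input —
# the algebraic residual count for `Sel_{p^∞}(E/ℚ_∞)` ITSELF (Greenberg–Vatsal's display (16) with
# (11) for the ADDITIVE curve) suffices; `W`-level branch main conjecture and the Λ-adic containment
# `ChiBranchLowerDivisibilityAt W p` from PRINT + that count (cell `bsd-addord`, seat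
# `bsd-addord-twist`, strategy = twist transport; sequel of `X3BranchAnalyticHalfGord[EndState].lean`)

HONEST FRAMING (cell `bsd-addord`, `run/shared/lean/pub/bsd-addord/README.md` §4): the programme's
target of record is the full Birch–Swinnerton-Dyer formula for every `E/ℚ` of analytic rank `≤ 1`;
this file concerns the X3 rows of cell (G-ord, `e = 2`) of N10 only and books NOTHING: X3 stays
CONSTRUCTION-SHAPED. THEOREMS ONLY (no `def`, no named fact, no `sorry`). PUBLISHED inputs are the
explicit named-fact binders `hW16` (Wuthrich 2014 Thm. 16, half-eigen reading) and `hGV`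
(Greenberg–Vatsal 2000 Thm. (3.12) on the `ω^{(p−1)/2}`-branch at a good ordinary prime,
reading-fact p396718). The ONE unprinted input is the DISPLAYED hypothesis `hAlgW` below — never
asserted.

## What and why

The sibling `X3BranchAnalyticHalfGord.lean` reduced the `ω^{(p−1)/2}`-branch main conjecture of the
good-ordinary twist `V = E♭` to ONE displayed statement `hAlg` about the half-eigen Iwasawa modules
`e_m X(V/ℚ(μ_{p^∞}))` (Wuthrich's vocabulary, `EigenSelmerDualData`). Greenberg–Vatsal's algebraic
method (§2 (16), (11)) and the tree's kernel version of it (the X2 chain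
`X2/ResidualDevissageGoodOrdinary.natCard_line_mul_quotSelmer_eq_of_goodOrd`:
`#H¹(ℚ_Σ/ℚ_∞, Φ₀)·#S^{Σ₀}_{E[p]/Φ₀}(ℚ_∞) = p^{λ(E)+Σδ}` for `μ(E) = 0`, stated on the CLASSICAL
dual data `WeierstrassCurve.SelmerDualData`) live instead on the Selmer group of the curve ITSELF
over `ℚ_∞`. THIS FILE transports the open input along the twist (the seat's strategy): by the tree's
eigen-descent `SelmerDualData.exists_chiEigenInCyclotomic` (additive-p2: every `Λ`-dual datum `D` of
`Sel_{p^∞}(E/ℚ_∞)` descends to a `χ_K`-eigen datum `D'` of `Sel_{p^∞}(E♭/ℚ(μ_{p^∞}))` with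
`char_Λ D'.X = char_Λ D.X`), the composition of the sibling runs POINTWISE at `D'`, and the count it
needs is the count for `D`. Hence:

* §1 `X3Branch.charIdeal_eq_span_of_thm312_of_count` — the sibling's composition POINTWISE: for ONE
  half-eigen datum `D` of `V`, `hW16 ∧ hGV ∧` [the count for the generators of `char D.X`] ⟹
  `D.X` torsion and `char D.X = (g')` with `ι g' = u·ϖ·L_p(f_V, α, ω^m, T)`.
* §2 **`X3Branch.charIdeal_eq_span_of_thm312_of_algebraicCountW`** — for `V` GOOD ORDINARY at the odd
  prime `p`, `C • V^{(p*)} = W`, `f` the newform of `V`, `κ` cyclotomic with topological generator `γ`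
  matching the cyclotomic variable, EVERY `Λ`-dual datum `D` of `Sel_{p^∞}(W/ℚ_∞)` and the period
  ratio `ϖ` of the parity of `m`: `X(W/ℚ_∞)` is `Λ`-torsion and `char_Λ X(W/ℚ_∞) = (g')`,
  `ι g' = u·ϖ·L_p(f_V, α, ω^m, T)` — i.e. Delbourgo's Main Conjecture (G) of the ADDITIVE `E = W` in
  Greenberg form, on the branch-parity rows — from `hW16`, `hGV` and the displayed
  **`hAlgW` := for every cyclotomic `κ`, topological generator `γ`, `Λ`-dual datum `D` of
  `Sel_{p^∞}(W/ℚ_∞)` and generator `g` of `char_Λ D.X` with `μ(g) = 0`: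
  `p^{λ(g) + Σ_{ℓ∈Σ₀} δ_ℓ(W)} = #H¹(ℚ_Σ/ℚ_∞, Φ₀)·#U(W[p]/Φ₀)`** — GV's (16)+(11) for `W`, the
  additive-prime twin of `natCard_line_mul_quotSelmer_eq_of_goodOrd` (there `λ(E)` =
  `lambdaInvariant` of the module, = `λ(g)` of any generator at `μ = 0` by the tree's
  `lam_generator_eq_lambdaInvariant`).
* §3 `X3Branch.chiBranchLowerDivisibilityAt_of_thm312_of_algebraicCountW` — `p ≡ 1 (mod 4)`: the
  tree's Λ-adic INTEGRAL containment `ChiBranchLowerDivisibilityAt W p` (additive-p2, the `hΛ` slot of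
  this seat's `N10TwistClauseBSTW121c.lean` §4 on the X4 rows) from `hW16 ∧ hGV ∧ hAlgW` — no class
  hypothesis (the def quantifies over good-ordinary twist data). The `T = 0` inputs, `CycLower…`,
  `Typed.MissingLowerBoundAt` and `BSDp` (both parities, `p = 3` included) are the sibling
  `X3BranchAnalyticHalfGordDescentEndState.lean`.

So the residue of T-X3-χ on (G-ord, `e = 2`) is now ONE statement about the additive curve's own
Selmer group over `ℚ_∞` — the exact output shape of the X2 devissage kernel, to be re-run with the
ramified-line Greenberg datum at the additive prime (cell `bsd-eis` x3 R1; seat memo v1 App. A L1–L9).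

## What this is NOT

Not a class theorem; `hAlgW` is OPEN (not in print at an additive prime; not in the kernel). Not the
(M) cell (`X3BranchMultCongruence.lean`), not the degenerate `p = 3` rows, not rank `1`.

References: [GreenbergVatsal2000] §2 (11), (16) pp. 28–30, §3 Thm. (3.12) p. 45, p. 4;
[Wuthrich2014] Thm. 16; [GreenbergLNM1716] §5 p. 143 (eigen-descent); [Delbourgo1998] §2, Main
Conjecture p. 151; [SkinnerUrban2014] Thm. 3.6.4 (shape of `ChiBranchLowerDivisibilityAt` only).
-/

set_option autoImplicit false

noncomputable section

open scoped Classical MatrixGroups ModularForm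

namespace Summit.BirchSwinnertonDyer.Rank1Residual.Additive

open CongruenceSubgroup WeierstrassCurve NumberField IsDedekindDomain Field
  Literature.NumberTheory.EllipticCurves
  Literature.NumberTheory.EllipticCurves.ModularForms
  Literature.NumberTheory.EllipticCurves.GreenbergVatsal2000
  Literature.NumberTheory.EllipticCurves.Rank1Residual
  Literature.NumberTheory.EllipticCurves.Rank1Residual.Typed
  Literature.NumberTheory.GaloisRepresentations
  Summit.BirchSwinnertonDyer.Rank1Residual.X1.MuLambda
  Summit.BirchSwinnertonDyer.Rank1Residual.AdditivePotMult
  Summit.BirchSwinnertonDyer.Rank1Residual.Additive.X3Branch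

/-! ### §1 Pointwise form of the eigen-level composition -/

section Pointwise

variable {V : WeierstrassCurve ℚ} [V.IsElliptic] [V.IsGloballyMinimal]
  {W : WeierstrassCurve ℚ} [W.IsElliptic] [W.IsGloballyMinimal] {p : ℕ} [hp : Fact p.Prime]

/-- **The composition of `X3BranchAnalyticHalfGord.lean`, POINTWISE in the half-eigen datum.** For
`V` good ordinary at `p` (odd on use), `C • V^{(p*)} = W`, `Σ₀`/`Φ₀` data on `W` as in the sibling
(`Φ₀` even, non-trivial `Γ_ℚ`-action, `χ_K`-twist ramified at `p`), ONE telescope instance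
`(K, F, κ, γ, f)` and ONE half-eigen `Λ`-dual datum `D` of `V` with period ratio `ϖ`: if every
generator `g` of `char_Λ D.X` with `μ(g) = 0` satisfies `p^{λ(g)+Σδ} = #H¹(ℚ_Σ/ℚ_∞, Φ₀)·#U`
(`hcount`), then `D.X` is `Λ`-torsion and `char_Λ D.X = (g')` with `ι g' = u·ϖ·L_p(f_V, α, ω^m, T)`.
Proof = the sibling's (Wuthrich `g' = g·h`; analytic half at `b := g·h`; `hcount` at `g`;
`λ(gh) = λ(g)`; `h ∈ Λˣ`). [cite: GreenbergVatsal2000, p. 4, §3 Thm. (3.12) p. 45] [cite: Wuthrich2014, Thm. 16 (p. 397)] -/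
theorem X3Branch.charIdeal_eq_span_of_thm312_of_count
    (hW16 : Wuthrich2014.thm16_halfEigenCharIdeal_dvd_cyclotomicPrime)
    (hGV : thm312_branch_unitContent_and_lambda_eq_residual_goodOrd)
    (hgood : GoodOrd V p)
    (htw : ∃ C : VariableChange ℚ, C • V.quadraticTwist ((-1) ^ (p / 2) * p : ℚ) = W)
    (S₀ : Finset (HeightOneSpectrum (𝓞 ℚ))) (hS₀ : ∀ v ∈ S₀, ((p : ℕ) : 𝓞 ℚ) ∉ v.asIdeal)
    (hS : ∀ v : HeightOneSpectrum (𝓞 ℚ), v ∉ S₀ → ((p : ℕ) : 𝓞 ℚ) ∉ v.asIdeal →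
      W.HasGoodReductionAt v)
    (Φ₀ : AddSubgroup (W.geomTorsion (p : ℤ))) (hΦ : IsRationalLine W p Φ₀)
    (heven : LineEven W p Φ₀)
    (hnt : ∃ (σ : absoluteGaloisGroup ℚ) (P : W.geomTorsion (p : ℤ)), P ∈ Φ₀ ∧ σ • P ≠ P)
    (K : Type) [Field K] [NumberField K] [(galRange (K := ℚ) K).Normal]
    (F : Type) [Field F] [NumberField F] [IsCyclotomicExtension {p} ℚ F]
    [(galRange (K := ℚ) F).Normal]
    {κ : ZpExtension ℚ p} {γ : Field.absoluteGaloisGroup ℚ} {N : ℕ} [NeZero N]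
    {f : CuspForm (Gamma0 N) 2}
    (hp2 : p ≠ 2) (h2 : Module.finrank ℚ K = 2)
    (hθ : ∃ θ : K, θ ^ 2 = algebraMap ℚ K ((-1) ^ (p / 2) * p))
    (hram : ¬ ∀ v : HeightOneSpectrum (𝓞 ℚ), ((p : ℕ) : 𝓞 ℚ) ∈ v.asIdeal →
        ∀ 𝔓 ∈ v.primesAbove, ∀ σ ∈ 𝔓.inertia (absoluteGaloisGroup ℚ), ∀ P ∈ Φ₀,
          σ • P = (if σ ∈ galRange (K := ℚ) K then P else -P))
    (hirr : ¬ V.HasIrreducibleModPGaloisRep p)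
    (hκ : κ.IsCyclotomic) (hγ : κ.IsTopGenerator γ) (hcyc : IsCyclotomicVariable p γ)
    (hγK : γ ∈ galRange (K := ℚ) K) (hγF : γ ∈ galRange (K := ℚ) F) (hf : IsNewformOf V f)
    (D : V.EigenSelmerDualData p
        (κ.kerSubgroup ⊓ galRange (K := ℚ) K ⊓ galRange (K := ℚ) F) κ.kerSubgroup
        (fun g ↦ if g ∈ galRange (K := ℚ) K then 1 else -1) γ)
    (ϖ : ℚ) (hϖ : if Even (p / 2) then (ϖ : ℝ) * V.realPeriodRat = plusPeriod f
        else (ϖ : ℝ) * V.imaginaryPeriodRat = minusPeriod f)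
    (hcount : ∀ g : IwasawaAlgebra p, D.charIdeal = Ideal.span {g} → HasUnitContent g →
      p ^ (lam g + ∑ v ∈ S₀, delta W p v) =
        Nat.card (residualLineH1 W p κ S₀ Φ₀ hΦ) * Nat.card (residualQuotSelmer W p κ S₀ Φ₀ hΦ)) :
    Module.IsTorsion (IwasawaAlgebra p) D.X ∧
      ∃ g' : IwasawaAlgebra p, D.charIdeal = Ideal.span {g'} ∧ ∃ u : ℤ_[p]ˣ,
        iwasawaToPowerSeries p g' =
          PowerSeries.C (((u : ℤ_[p]) : ℚ_[p]) * (ϖ : ℚ_[p])) *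
            (if Even (p / 2) then padicLFunctionBranch f ((unitRoot V p : ℤ_[p]) : ℚ_[p]) (p / 2)
              else padicLFunctionMinusBranch f ((unitRoot V p : ℤ_[p]) : ℚ_[p]) (p / 2)) := by
  have hord : IsOrdinaryAt V p := (isOrdinaryAt_iff V p).mpr ⟨hgood.1, hgood.2⟩
  obtain ⟨htors, g', hg'mem, u, hι⟩ :=
    hW16 p V K F _ hp2 h2 hθ (Or.inl ⟨hord, rfl⟩) hirr hκ hγ hcyc hγK hγF hf D ϖ hϖ
  refine ⟨htors, ?_⟩
  obtain ⟨g, hg⟩ := (charIdeal_isPrincipal_holds p D.X).principal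
  have hchar : D.charIdeal = Ideal.span {g} := hg
  have hdvd : g ∣ g' := by
    rw [hchar] at hg'mem
    exact Ideal.mem_span_singleton.mp hg'mem
  obtain ⟨h, hfac⟩ := hdvd
  subst hfac
  obtain ⟨hμan, hAn⟩ := X3Branch.analyticHalf_goodOrd_of_thm312 hGV K κ f S₀ Φ₀ hΦ hp2 hgood hirr h2
    hθ htw hκ hf heven hnt hram hS₀ hS ϖ hϖ (g * h) u hι
  have hμalg : HasUnitContent g := X11a.hasUnitContent_left_of_mul hμan
  have hAl := hcount g hchar hμalg
  have hlam : lam (g * h) = lam g := by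
    have hpow : p ^ (lam (g * h) + ∑ v ∈ S₀, delta W p v) = p ^ (lam g + ∑ v ∈ S₀, delta W p v) :=
      hAn.trans hAl.symm
    have := Nat.pow_right_injective hp.out.two_le hpow
    omega
  refine ⟨g * h, hchar.trans ?_, u, hι⟩
  exact (span_mul_eq_span_of_hasUnitContent_of_lam_le (X11a.ne_zero_of_hasUnitContent hμalg) hμan
    hlam.le).symm

end Pointwise

/-! ### §2 TWIST DESCENT of the open hypothesis: the count for `Sel_{p^∞}(E/ℚ_∞)` itself suffices -/

section Descent

variable {V : WeierstrassCurve ℚ} [V.IsElliptic] [V.IsGloballyMinimal]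
  {W : WeierstrassCurve ℚ} [W.IsElliptic] [W.IsGloballyMinimal] {p : ℕ} [hp : Fact p.Prime]

/-- **TWIST DESCENT of the open input: the `W`-level branch main conjecture from PRINT + the count for
`Sel_{p^∞}(W/ℚ_∞)` itself.** `V` GOOD ORDINARY at the odd `p`, `C • V^{(p*)} = W` (`W = E` additive),
`Σ₀ ∌ p` finite with the bad places `≠ p` inside, `Φ₀ ≤ W[p]` a rational line, EVEN, non-trivial
`Γ_ℚ`-action, `χ_K`-twist ramified at `p` for every quadratic `K` with `θ² = p*`; `κ` cyclotomic,
`γ` a topological generator matching the cyclotomic variable, `f` the newform of `V`, `D` ANY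
`Λ`-dual datum of `Sel_{p^∞}(W/ℚ_∞)`, `ϖ` the period ratio of the parity of `m = (p−1)/2`. THEN
`X(W/ℚ_∞)` is `Λ`-torsion and `char_Λ X(W/ℚ_∞) = (g')` with `ι g' = u·ϖ·L_p(f_V, α_V, ω^m, T)`,
`u ∈ ℤ_pˣ` — GRANTED `hW16` (Wuthrich Thm. 16), `hGV` (GV Thm. (3.12) on the branch) and the
displayed `hAlgW`: for every cyclotomic `κ`, generator `γ`, dual datum `D` of `Sel_{p^∞}(W/ℚ_∞)` and
generator `g` of `char D.X` with `μ(g) = 0`, `p^{λ(g) + Σ_{ℓ∈Σ₀} δ_ℓ(W)} = #H¹(ℚ_Σ/ℚ_∞, Φ₀)·#U(W[p]/Φ₀)`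
(GV (16)+(11) for the additive `W`; NOT in print, NOT asserted). Proof: `W[p] ⊇ Φ₀` is reducible,
hence so is `V[p]` (`irr_iff_of_model_twist`); descend `D` to the `χ_K`-eigen datum `D'` over
`ℚ(μ_{p^∞})` with the same characteristic ideal (`SelmerDualData.exists_chiEigenInCyclotomic`,
`K ⊂ ℚ(ζ_p)`, generator `γ' = γ·g₀`, `g₀ ∈ ker κ`); run §1 at the Literature eigen datum
`D'.toEigen` (same module), feeding `hAlgW` at `D` as the count. [cite: GreenbergLNM1716, §5 (PDF p. 143)]
[cite: GreenbergVatsal2000, p. 4, §2 (16), §3 Thm. (3.12) p. 45] [cite: Wuthrich2014, Thm. 16 (p. 397)]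
[cite: Delbourgo1998, Main Conjecture (p. 151)] -/
theorem X3Branch.charIdeal_eq_span_of_thm312_of_algebraicCountW
    (hW16 : Wuthrich2014.thm16_halfEigenCharIdeal_dvd_cyclotomicPrime)
    (hGV : thm312_branch_unitContent_and_lambda_eq_residual_goodOrd)
    (hp2 : p ≠ 2) (hgood : GoodOrd V p) {C : VariableChange ℚ}
    (hC : C • V.quadraticTwist ((-1) ^ (p / 2) * p : ℚ) = W)
    (S₀ : Finset (HeightOneSpectrum (𝓞 ℚ))) (hS₀ : ∀ v ∈ S₀, ((p : ℕ) : 𝓞 ℚ) ∉ v.asIdeal)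
    (hS : ∀ v : HeightOneSpectrum (𝓞 ℚ), v ∉ S₀ → ((p : ℕ) : 𝓞 ℚ) ∉ v.asIdeal →
      W.HasGoodReductionAt v)
    (Φ₀ : AddSubgroup (W.geomTorsion (p : ℤ))) (hΦ : IsRationalLine W p Φ₀)
    (heven : LineEven W p Φ₀)
    (hnt : ∃ (σ : absoluteGaloisGroup ℚ) (P : W.geomTorsion (p : ℤ)), P ∈ Φ₀ ∧ σ • P ≠ P)
    (hram : ∀ (K : Type) [Field K] [NumberField K] [(galRange (K := ℚ) K).Normal],
      Module.finrank ℚ K = 2 → (∃ θ : K, θ ^ 2 = algebraMap ℚ K ((-1) ^ (p / 2) * p)) →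
      ¬ ∀ v : HeightOneSpectrum (𝓞 ℚ), ((p : ℕ) : 𝓞 ℚ) ∈ v.asIdeal →
        ∀ 𝔓 ∈ v.primesAbove, ∀ σ ∈ 𝔓.inertia (absoluteGaloisGroup ℚ), ∀ P ∈ Φ₀,
          σ • P = (if σ ∈ galRange (K := ℚ) K then P else -P))
    (hAlgW : ∀ {κ : ZpExtension ℚ p} {γ : Field.absoluteGaloisGroup ℚ} (D : W.SelmerDualData κ γ)
      (g : IwasawaAlgebra p), κ.IsCyclotomic → κ.IsTopGenerator γ →
      D.charIdeal = Ideal.span {g} → HasUnitContent g →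
        p ^ (lam g + ∑ v ∈ S₀, delta W p v) =
          Nat.card (residualLineH1 W p κ S₀ Φ₀ hΦ) * Nat.card (residualQuotSelmer W p κ S₀ Φ₀ hΦ))
    {κ : ZpExtension ℚ p} {γ : Field.absoluteGaloisGroup ℚ} {N : ℕ} [NeZero N]
    {f : CuspForm (Gamma0 N) 2}
    (hκ : κ.IsCyclotomic) (hγ : κ.IsTopGenerator γ) (hcv : IsCyclotomicVariable p γ)
    (hf : IsNewformOf V f) (D : W.SelmerDualData κ γ) (ϖ : ℚ)
    (hϖ : if Even (p / 2) then (ϖ : ℝ) * V.realPeriodRat = plusPeriod f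
        else (ϖ : ℝ) * V.imaginaryPeriodRat = minusPeriod f) :
    D.IsTorsion ∧ ∃ g' : IwasawaAlgebra p, D.charIdeal = Ideal.span {g'} ∧ ∃ u : ℤ_[p]ˣ,
      iwasawaToPowerSeries p g' =
        PowerSeries.C (((u : ℤ_[p]) : ℚ_[p]) * (ϖ : ℚ_[p])) *
          (if Even (p / 2) then padicLFunctionBranch f ((unitRoot V p : ℤ_[p]) : ℚ_[p]) (p / 2)
            else padicLFunctionMinusBranch f ((unitRoot V p : ℤ_[p]) : ℚ_[p]) (p / 2)) := by
  have hpS : ((-1 : ℚ) ^ (p / 2) * p) ≠ 0 := pStar_ne_zero p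
  -- `W[p]` has the rational line `Φ₀`, so `V[p]` is reducible too
  have hirr : ¬ V.HasIrreducibleModPGaloisRep p := fun hV ↦
    not_hasIrreducibleModPGaloisRep_of_isRationalLine hΦ
      ((irr_iff_of_model_twist (W := V) (p := p) hpS ⟨C, hC⟩).mpr hV)
  -- descend `D` to the `χ_K`-eigen datum over `ℚ(μ_{p^∞})`
  haveI hcycL : IsCyclotomicExtension {p} ℚ (CyclotomicField p ℚ) := by
    have h : (CyclotomicField.algebra p ℚ : Algebra ℚ (CyclotomicField p ℚ)) =
        DivisionRing.toRatAlgebra := Subsingleton.elim _ _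
    exact h ▸ CyclotomicField.isCyclotomicExtension p ℚ
  obtain ⟨K, θ, hK2, hθ, hθ2⟩ := exists_intermediateField_sq_eq_pStar p (CyclotomicField p ℚ) hp2
  haveI : NumberField K := NumberField.of_module_finite ℚ K
  haveI : IsGalois ℚ K := isGalois_of_finrank_eq_two K hK2
  haveI := normal_galRange K hK2 (sigmaQ_ne_one K hK2 hθ hθ2)
  haveI := normal_galRange_cyclotomic p (CyclotomicField p ℚ)
  haveI : (V.quadraticTwist ((-1 : ℚ) ^ (p / 2) * p)).IsElliptic := V.isElliptic_quadraticTwist hpS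
  obtain ⟨γ', hγ'KF, hκγ', ⟨g₀, hg₀, hγ'eq⟩, D', hchar, htor⟩ :=
    SelmerDualData.exists_chiEigenInCyclotomic p (CyclotomicField p ℚ) V K hK2 hθ hθ2 κ hC hp2 D
  -- the pointwise composition at the Literature eigen datum with the SAME module
  have key := X3Branch.charIdeal_eq_span_of_thm312_of_count (V := V) (W := W) hW16 hGV hgood ⟨C, hC⟩
    S₀ hS₀ hS Φ₀ hΦ heven hnt K (CyclotomicField p ℚ) (κ := κ) (γ := γ') (f := f) hp2 hK2 ⟨θ, hθ2⟩
    (hram K hK2 ⟨θ, hθ2⟩) hirr hκ (isTopGenerator_of_kappa_eq κ hκγ' hγ)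
    (isCyclotomicVariable_of_eq_mul p κ hκ hg₀ hγ'eq hcv)
    (Subgroup.mem_inf.mp hγ'KF).1 (Subgroup.mem_inf.mp hγ'KF).2 hf
    (ChiEigenSelmerInDualData.toEigen V K κ (galRange (K := ℚ) (CyclotomicField p ℚ)) γ' D') ϖ hϖ
    (fun g hg hμ ↦ hAlgW D g hκ hγ (hchar ▸ hg) hμ)
  obtain ⟨htors', g', hchar', u, hι⟩ := key
  exact ⟨htor.mp htors', g', hchar ▸ hchar', u, hι⟩

end Descent

/-! ### §3 `W`-level consequences: the Λ-adic containment (`p ≡ 1 (mod 4)`), the `T = 0` inputs, the END STATE -/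

section WLevel

variable {W : WeierstrassCurve ℚ} [W.IsElliptic] [W.IsGloballyMinimal] {p : ℕ} [hp : Fact p.Prime]

/-- **`p ≡ 1 (mod 4)`: the Λ-adic integral containment `ChiBranchLowerDivisibilityAt W p`**
("`char_Λ X(W/ℚ_∞) ⊆ (ϖ·L_p(f, α, ω^{(p−1)/2}, T))·Λ` for every good-ordinary twist datum and every
dual datum", additive-p2's typed LOWER input) **from `hW16 ∧ hGV ∧ hAlgW`** — §2 gives equality with
a unit, a fortiori containment. No class hypothesis: the def itself supplies the good-ordinary twist
model. Downstream (tree): `chiBranchLowerLeadingTermAt_of_divisibility_of_padicValRat_j_nonneg`,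
`cycLowerLeadingTermAt_iff_chiBranchLower_of_typeGOrd_of_semistabilityIndex_eq_two`, and this seat's
`N10TwistClauseBSTW121c.lean` §4 pattern. [cite: SkinnerUrban2014, Thm. 3.6.4 (p. 43) (shape only)]
[cite: GreenbergVatsal2000, §3 Thm. (3.12) p. 45] [cite: Wuthrich2014, Thm. 16 (p. 397)] -/
theorem X3Branch.chiBranchLowerDivisibilityAt_of_thm312_of_algebraicCountW
    (hW16 : Wuthrich2014.thm16_halfEigenCharIdeal_dvd_cyclotomicPrime)
    (hGV : thm312_branch_unitContent_and_lambda_eq_residual_goodOrd)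
    (S₀ : Finset (HeightOneSpectrum (𝓞 ℚ))) (hS₀ : ∀ v ∈ S₀, ((p : ℕ) : 𝓞 ℚ) ∉ v.asIdeal)
    (hS : ∀ v : HeightOneSpectrum (𝓞 ℚ), v ∉ S₀ → ((p : ℕ) : 𝓞 ℚ) ∉ v.asIdeal →
      W.HasGoodReductionAt v)
    (Φ₀ : AddSubgroup (W.geomTorsion (p : ℤ))) (hΦ : IsRationalLine W p Φ₀)
    (heven : LineEven W p Φ₀)
    (hnt : ∃ (σ : absoluteGaloisGroup ℚ) (P : W.geomTorsion (p : ℤ)), P ∈ Φ₀ ∧ σ • P ≠ P)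
    (hram : ∀ (K : Type) [Field K] [NumberField K] [(galRange (K := ℚ) K).Normal],
      Module.finrank ℚ K = 2 → (∃ θ : K, θ ^ 2 = algebraMap ℚ K ((-1) ^ (p / 2) * p)) →
      ¬ ∀ v : HeightOneSpectrum (𝓞 ℚ), ((p : ℕ) : 𝓞 ℚ) ∈ v.asIdeal →
        ∀ 𝔓 ∈ v.primesAbove, ∀ σ ∈ 𝔓.inertia (absoluteGaloisGroup ℚ), ∀ P ∈ Φ₀,
          σ • P = (if σ ∈ galRange (K := ℚ) K then P else -P))
    (hAlgW : ∀ {κ : ZpExtension ℚ p} {γ : Field.absoluteGaloisGroup ℚ} (D : W.SelmerDualData κ γ)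
      (g : IwasawaAlgebra p), κ.IsCyclotomic → κ.IsTopGenerator γ →
      D.charIdeal = Ideal.span {g} → HasUnitContent g →
        p ^ (lam g + ∑ v ∈ S₀, delta W p v) =
          Nat.card (residualLineH1 W p κ S₀ Φ₀ hΦ) * Nat.card (residualQuotSelmer W p κ S₀ Φ₀ hΦ)) :
    ChiBranchLowerDivisibilityAt W p := by
  intro V _ _ κ γ N _ f hp1 hCW hgood hκ hγ hcv hf D ϖ hϖ g hg
  have hp2 : p ≠ 2 := by omega
  have heven' : Even (p / 2) := ⟨p / 4, by omega⟩
  obtain ⟨C, hC⟩ := hCW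
  have hC' : C • V.quadraticTwist ((-1) ^ (p / 2) * p : ℚ) = W := by
    rw [pStar_eq_self_of_mod_four_eq_one hp1]; exact hC
  obtain ⟨-, g', hchar, u, hι⟩ := X3Branch.charIdeal_eq_span_of_thm312_of_algebraicCountW hW16 hGV
    hp2 hgood hC' S₀ hS₀ hS Φ₀ hΦ heven hnt hram hAlgW hκ hγ hcv hf D ϖ (by rw [if_pos heven']; exact hϖ)
  rw [if_pos heven'] at hι
  have hg' : g ∈ Ideal.span ({g'} : Set (IwasawaAlgebra p)) := by rw [← hchar]; exact hg
  obtain ⟨a, rfl⟩ := Ideal.mem_span_singleton'.mp hg'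
  refine ⟨PowerSeries.C (u : ℤ_[p]) * a, ?_⟩
  have hCu : PowerSeries.C ((((u : ℤ_[p]) : ℚ_[p])) * (ϖ : ℚ_[p])) =
      PowerSeries.C (((u : ℤ_[p]) : ℚ_[p])) * PowerSeries.C (ϖ : ℚ_[p]) := map_mul _ _ _
  rw [map_mul, hι, iwasawaToPowerSeries_C_mul', hCu]
  ring

end WLevel

end Summit.BirchSwinnertonDyer.Rank1Residual.Additive

end
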